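import Literature.Probability.RandomPlanarGeometry.RadialSLETrace
import Literature.Probability.RandomPlanarGeometry.RadialLoewnerLocality
import HarnessLib

/-!
# Causality of the radial horizon and of local generation (stopped driving paths)

Topic `Probability/RandomPlanarGeometry`; definitions with bodies (`stopPath`, `pathHorizon`) and
proved theorems (no named fact). Sequel of `RadialSLETrace` and `RadialLoewnerLocality`. The
absolute continuity of the whole-plane driving increments with respect to Brownian motion
(`IsStationaryAngleLaw.drivingIncrement_shift_null_of_brownian_null`) is a statement about paths
**stopped at a deterministic time `T`**; the radial theory (`RadialSLE.ae_locallyGeneratedSimple`)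
speaks about the unstopped driving path up to the random horizon `ρ = T ∧ S ≤ T`. This file shows
that nothing is lost in between: the horizon and the local generation property up to the horizon
are functionals of the path restricted to `[0, T]`.

* `Process.min_exitTime_eq_of_eqOn` — `T ∧ (exit time)` depends on the path on `[0, T]` only;
* `RadialLoewner.pathFlow_eq_of_eqOn` — the (level-`n` stopped) angle flow is causal;
* `RadialSLE.pathHorizon n ε T p` — the horizon `T ∧ S` as a functional of the driving path, with
  `RadialSLE.horizon_eq_pathHorizon`, `pathHorizon_eq_of_eqOn`, `pathHorizon_le`, `pathHorizon_pos`;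
* `RadialSLE.LocallyGeneratedSimple.of_eqOn` — local generation up to `u₁ ≤ T` depends on the
  driver on `[0, T]` only (`RadialLoewner.Disc.domain_eq_of_eqOn`, `invFunOn_map_eq_of_eqOn`);
* `RadialSLE.ae_locallyGeneratedSimple_stopPath` — hence, for every Brownian motion `B` and
  `κ ≤ 4`, almost surely the `T`-stopped driving path `√κ B(· ∧ T)` is locally generated (inside the
  disc) up to the horizon, which is its own path horizon.

## References

* G. F. Lawler, *Conformally Invariant Processes in the Plane*, AMS (2005), §4.2, §6.5. [Lawler2005]
* J. Miller, S. Sheffield, *Imaginary geometry IV*, PTRF 169 (2017), Prop. 2.5 (proof).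
  [MillerSheffield2013]
-/

noncomputable section

open MeasureTheory ProbabilityTheory Filter Topology Set Metric Complex
open scoped NNReal ENNReal Real

namespace Literature.Probability

/-! ### Exit times are causal -/

namespace Process

/-- **`T ∧ τ` is a functional of the path on `[0, T]`** (`τ` the exit time from `(a, b)` of a
continuous path). [folklore] -/
theorem min_exitTime_eq_of_eqOn {Ω Ω' : Type*} {u : ℝ≥0 → Ω → ℝ} {u' : ℝ≥0 → Ω' → ℝ} {ω : Ω} {ω' : Ω'}
    (hc : Continuous fun t ↦ u t ω) (hc' : Continuous fun t ↦ u' t ω') {T : ℝ≥0}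
    (h : ∀ t : ℝ≥0, t ≤ T → u t ω = u' t ω') (a b : ℝ) :
    min (T : WithTop ℝ≥0) (exitTime u a b ω) = min (T : WithTop ℝ≥0) (exitTime u' a b ω') := by
  have hiff : ∀ t : ℝ≥0, t ≤ T → (exitTime u a b ω ≤ t ↔ exitTime u' a b ω' ≤ t) := by
    intro t ht
    rw [exitTime_le_coe_iff hc, exitTime_le_coe_iff hc']
    constructor
    · rintro ⟨j, hj, hjm⟩; exact ⟨j, hj, by rwa [← h j (hj.trans ht)]⟩
    · rintro ⟨j, hj, hjm⟩; exact ⟨j, hj, by rwa [h j (hj.trans ht)]⟩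
  -- abstract nonsense on `WithTop ℝ≥0`
  set τ := exitTime u a b ω with hτ
  set τ' := exitTime u' a b ω' with hτ'
  by_cases hle : τ ≤ T
  · obtain ⟨t₀, ht₀⟩ := WithTop.ne_top_iff_exists.1 (ne_top_of_le_ne_top WithTop.coe_ne_top hle)
    have ht₀T : t₀ ≤ T := by rw [← WithTop.coe_le_coe, ht₀]; exact hle
    have h1 : τ' ≤ t₀ := (hiff t₀ ht₀T).1 (by rw [ht₀])
    obtain ⟨t₁, ht₁⟩ := WithTop.ne_top_iff_exists.1 (ne_top_of_le_ne_top WithTop.coe_ne_top h1)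
    have ht₁t₀ : t₁ ≤ t₀ := by rw [← WithTop.coe_le_coe, ht₁]; exact h1
    have h2 : τ ≤ t₁ := (hiff t₁ (ht₁t₀.trans ht₀T)).2 (by rw [ht₁])
    have ht₀t₁ : t₀ ≤ t₁ := by rw [← WithTop.coe_le_coe, ht₀]; exact h2
    have : τ = τ' := by rw [← ht₀, ← ht₁, le_antisymm ht₀t₁ ht₁t₀]
    rw [this]
  · have hle' : ¬ τ' ≤ T := fun h' ↦ by
      obtain ⟨t₁, ht₁⟩ := WithTop.ne_top_iff_exists.1 (ne_top_of_le_ne_top WithTop.coe_ne_top h')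
      have ht₁T : t₁ ≤ T := by rw [← WithTop.coe_le_coe, ht₁]; exact h'
      exact hle (((hiff t₁ ht₁T).2 (by rw [ht₁])).trans (WithTop.coe_le_coe.2 ht₁T))
    rw [min_eq_left (not_le.1 hle).le, min_eq_left (not_le.1 hle').le]

end Process

namespace RandomPlanarGeometry

/-! ### The angle flow is causal -/

namespace RadialLoewner

open Literature.Probability.Process Literature.Analysis.FunctionSpaces

/-- **The truncated angle flow of a path is causal**: paths agreeing on `[0, T]` have the same
level-`δ` flow on `[0, T]` (uniqueness of the integrated equation, `eqOn_argTrunc_of_integral_eq`).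
[folklore] -/
theorem argTrunc_cpath_eq_of_eqOn {δ : ℝ} (hδ : 0 < δ) (hδ' : δ ≤ Real.pi / 2) (θ : ℝ)
    {p p' : CPath} {T : ℝ≥0} (h : ∀ t : ℝ≥0, t ≤ T → p.1 t = p'.1 t) :
    ∀ t : ℝ≥0, t ≤ T → argTrunc cpathDriving δ continuous_cpathDriving hδ hδ' θ t p =
      argTrunc cpathDriving δ continuous_cpathDriving hδ hδ' θ t p' := by
  refine eqOn_argTrunc_of_integral_eq continuous_cpathDriving hδ hδ' θ p'
    (continuous_argTrunc continuous_cpathDriving hδ hδ' θ p) (fun s hs ↦ ?_)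
  have := argTrunc_eq_integral continuous_cpathDriving hδ hδ' θ p (t := s)
  rwa [show cpathDriving p s = cpathDriving p' s from h s hs,
    show cpathDriving p 0 = cpathDriving p' 0 from h 0 bot_le] at this

/-- **The level-`n` stopped angle flow of a path is causal.** [folklore] -/
theorem pathFlow_eq_of_eqOn (n : ℕ) (θ : ℝ) {p p' : CPath} {T : ℝ≥0}
    (h : ∀ t : ℝ≥0, t ≤ T → p.1 t = p'.1 t) :
    ∀ t : ℝ≥0, t ≤ T → pathFlow n θ t p = pathFlow n θ t p' := by
  intro t ht
  have hflow := argTrunc_cpath_eq_of_eqOn (level_pos n) (level_le n) θ h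
  have hmin := Process.min_exitTime_eq_of_eqOn
    (continuous_argTrunc continuous_cpathDriving (level_pos n) (level_le n) θ p)
    (continuous_argTrunc continuous_cpathDriving (level_pos n) (level_le n) θ p')
    (fun s hs ↦ hflow s hs) (2 * level n) (2 * Real.pi - 2 * level n)
  -- `pathFlow t = argTrunc (t ∧ σ)`, and `t ∧ σ = t ∧ (T ∧ σ)` for `t ≤ T`
  simp only [pathFlow, stoppedProcess, argLevel, exitLevel, truncExit]
  set σ := Process.exitTime (argTrunc cpathDriving (level n) continuous_cpathDriving (level_pos n) (level_le n) θ)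
    (2 * level n) (2 * Real.pi - 2 * level n) p with hσ
  set σ' := Process.exitTime (argTrunc cpathDriving (level n) continuous_cpathDriving (level_pos n) (level_le n) θ)
    (2 * level n) (2 * Real.pi - 2 * level n) p' with hσ'
  have hkey : min (t : WithTop ℝ≥0) σ = min (t : WithTop ℝ≥0) σ' := by
    have ht' : (t : WithTop ℝ≥0) = min (t : WithTop ℝ≥0) T := (min_eq_left (WithTop.coe_le_coe.2 ht)).symm
    rw [ht', min_assoc, min_assoc, hmin]
  rw [hkey]
  have hle : (min (t : WithTop ℝ≥0) σ').untopA ≤ T := (untopA_min_le t σ').trans ht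
  exact hflow _ hle

end RadialLoewner

/-! ### The horizon as a functional of the driving path -/

namespace RadialSLE

open RadialLoewner SchrammWilson Literature.Probability.Process Literature.Analysis.FunctionSpaces

/-- The path stopped at time `T`: `p(· ∧ T)`. [folklore] -/
def stopPath (T : ℝ≥0) (p : ℝ≥0 → ℝ) : ℝ≥0 → ℝ := fun t ↦ p (min t T)

/-- Unfolding of `stopPath`. [folklore] -/
@[simp] theorem stopPath_apply (T : ℝ≥0) (p : ℝ≥0 → ℝ) (t : ℝ≥0) : stopPath T p t = p (min t T) := rfl

/-- The stopped path agrees with the path on `[0, T]`. [folklore] -/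
theorem stopPath_eq_of_le {T t : ℝ≥0} (p : ℝ≥0 → ℝ) (ht : t ≤ T) : stopPath T p t = p t := by
  rw [stopPath_apply, min_eq_left ht]

/-- The stopped path of a continuous path is continuous. [folklore] -/
theorem continuous_stopPath (T : ℝ≥0) {p : ℝ≥0 → ℝ} (hp : Continuous p) : Continuous (stopPath T p) :=
  hp.comp (continuous_id.min continuous_const)

/-- Scaling commutes with stopping. [folklore] -/
theorem stopPath_const_mul (T : ℝ≥0) (c : ℝ) (p : ℝ≥0 → ℝ) :
    stopPath T (fun t ↦ c * p t) = fun t ↦ c * stopPath T p t := rfl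

/-- **The radial horizon as a functional of the driving path**: `T ∧ S`, `S` the exit time of the
level-`n` stopped angle flow of the path (started at `π`) from `(2ε, 2π - 2ε)`. [folklore] -/
def pathHorizon (n : ℕ) (ε : ℝ) (T : ℝ≥0) (p : CPath) : ℝ≥0 :=
  (min (T : WithTop ℝ≥0) (bandExit ε (fun t (q : CPath) ↦ pathFlow n π t q) p)).untopA

/-- `pathHorizon ≤ T`. [folklore] -/
theorem pathHorizon_le (n : ℕ) (ε : ℝ) (T : ℝ≥0) (p : CPath) : pathHorizon n ε T p ≤ T := untopA_min_le T _

/-- The coercion of the path horizon. [folklore] -/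
theorem coe_pathHorizon (n : ℕ) (ε : ℝ) (T : ℝ≥0) (p : CPath) :
    (pathHorizon n ε T p : WithTop ℝ≥0) = min (T : WithTop ℝ≥0) (bandExit ε (fun t (q : CPath) ↦ pathFlow n π t q) p) :=
  coe_untopA_min T _

/-- **The path horizon is positive** (`T > 0`, `2ε < π`): the flow starts at `π`, inside the
band. [folklore] -/
theorem pathHorizon_pos (n : ℕ) {ε : ℝ} (hε2 : ε < π / 2) {T : ℝ≥0} (hT : 0 < T)
    (p : CPath) : 0 < pathHorizon n ε T p := by
  rw [← WithTop.coe_lt_coe, coe_pathHorizon, WithTop.coe_zero, lt_min_iff]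
  refine ⟨WithTop.coe_lt_coe.2 hT, ?_⟩
  refine Process.exitTime_pos (continuous_pathFlow n π p) ?_
  have h0 : pathFlow n π 0 p = π := by
    rw [pathFlow, stoppedProcess, untopA_min_zero]; exact argTrunc_zero _ _ _ π p
  rw [h0]
  constructor <;> nlinarith [Real.pi_pos, level_pos n]

variable {Ω : Type*} {mΩ : MeasurableSpace Ω} {κ : ℝ≥0} {B : ℝ≥0 → Ω → ℝ}
  {hBc : ∀ ω, Continuous (B · ω)}

/-- **The horizon of a sample is the path horizon of its driving path.** [folklore] -/
theorem horizon_eq_pathHorizon (n : ℕ) (ε : ℝ) (T : ℝ≥0) (ω : Ω) :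
    horizon κ B hBc n ε T ω = pathHorizon n ε T (bmPath κ B hBc ω) := by
  apply WithTop.coe_injective
  rw [coe_horizon, coe_pathHorizon]
  exact congrArg (min (T : WithTop ℝ≥0)) (Process.exitTime_eq_of_path_eq (fun t ↦ bmFlow_eq_pathFlow t ω) _ _)

/-- **The path horizon is causal**: paths agreeing on `[0, T]` have the same horizon. [folklore] -/
theorem pathHorizon_eq_of_eqOn (n : ℕ) (ε : ℝ) {T : ℝ≥0} {p p' : CPath}
    (h : ∀ t : ℝ≥0, t ≤ T → p.1 t = p'.1 t) : pathHorizon n ε T p = pathHorizon n ε T p' := by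
  apply WithTop.coe_injective
  rw [coe_pathHorizon, coe_pathHorizon]
  exact Process.min_exitTime_eq_of_eqOn (continuous_pathFlow n π p) (continuous_pathFlow n π p')
    (pathFlow_eq_of_eqOn n π h) _ _

/-- The path horizon of the stopped path. [folklore] -/
theorem pathHorizon_stopPath (n : ℕ) (ε : ℝ) (T : ℝ≥0) (p : CPath) :
    pathHorizon n ε T ⟨stopPath T p.1, continuous_stopPath T p.2⟩ = pathHorizon n ε T p :=
  pathHorizon_eq_of_eqOn n ε fun _ ht ↦ stopPath_eq_of_le p.1 ht

/-! ### Local generation is causal -/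

/-- **Local generation up to `u₁ ≤ T` depends on the driver on `[0, T]` only.**
[cite: Lawler2005, §4.2] -/
theorem LocallyGeneratedSimple.of_eqOn {V V' : ℝ≥0 → ℝ} {u₁ : ℝ} (h : LocallyGeneratedSimple V u₁)
    (hV : Continuous V) (hV' : Continuous V') {T : ℝ≥0} (heq : ∀ s : ℝ≥0, s ≤ T → V s = V' s)
    (hu₁ : u₁ ≤ T) : LocallyGeneratedSimple V' u₁ := by
  intro u₂ hu₂
  obtain ⟨η, h1, h2, h3, h4, h5⟩ := h u₂ hu₂
  refine ⟨η, h1, h2, h3, h4, fun u hu ↦ ?_⟩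
  have huT : u ≤ T := by
    have : (u : ℝ) ≤ T := ((NNReal.coe_le_coe.2 hu).trans hu₂.le).trans hu₁
    exact_mod_cast this
  have heq' : ∀ s : ℝ≥0, s ≤ u → V s = V' s := fun s hs ↦ heq s (hs.trans huT)
  obtain ⟨hdom, htip⟩ := h5 u hu
  refine ⟨?_, ?_⟩
  · rw [← RadialLoewner.Disc.domain_eq_of_eqOn hV hV' heq', hdom]
  · rw [← heq u huT]
    refine htip.congr' ?_
    filter_upwards [Ioo_mem_nhdsLT (show (0 : ℝ) < 1 by norm_num)] with r hr
    refine RadialLoewner.Disc.invFunOn_map_eq_of_eqOn hV hV' heq' ?_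
    rw [mem_ball_zero_iff, norm_mul, Complex.norm_exp_ofReal_mul_I, mul_one, Complex.norm_real,
      Real.norm_eq_abs, abs_of_pos hr.1]
    exact hr.2

/-! ### Almost surely, the stopped driving path of a Brownian sample is locally generated -/

variable {P : Measure Ω}

/-- **For every Brownian motion and `κ ≤ 4`, the `T`-stopped driving path is almost surely locally
generated inside the disc up to the horizon** (`ae_of_chordal` with the simple-phase chordal input
and the causal consequence `u₁ ≤ T → LocallyGeneratedSimple (V(· ∧ T)) u₁`).
[cite: Lawler2005, §6.5 Prop. 6.21] -/
theorem ae_locallyGeneratedSimple_stopPath [IsProbabilityMeasure P] (hB : IsBrownianReal B P)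
    (hBm : ∀ t, Measurable (B t)) (hBc : ∀ ω, Continuous (B · ω)) (hB0 : ∀ ω, B 0 ω = 0)
    (hκ : 0 < κ) (hκ4 : κ ≤ 4) {n : ℕ} {ε : ℝ} (hε : 0 < ε) (hε2 : ε < π / 2) (hnε : 2 * level n < ε / 2)
    (T : ℝ≥0) :
    ∀ᵐ ω ∂P, LocallyGeneratedSimple (stopPath T (bmDriving κ B ω)) (horizon κ B hBc n ε T ω) := by
  have h := ae_of_chordal hB hBm hBc hB0 hκ hε hε2 hnε T (fun γ ↦ ∀ t : ℝ≥0, 0 < t → 0 < (γ t).im)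
    (fun P' _ B' hB' hB'm hB'c ↦ by
      filter_upwards [ae_isSimpleTrace_of_isBrownianReal hB' hB'm hB'c hκ hκ4] with p ⟨γ, hγ, hs⟩
      exact ⟨γ, hγ, hs.2⟩)
    (fun V u₁ ↦ u₁ ≤ T → LocallyGeneratedSimple (stopPath T V) u₁)
    (fun hu₁ hY hYI hV hV0 hYeq _ hWt hagree _ hγ hpos hu₁T ↦
      (locallyGeneratedSimple_of_agree hu₁ hY hYI hV hV0 hYeq hWt hagree hγ hpos).of_eqOn hV
        (continuous_stopPath T hV) (fun s hs ↦ (stopPath_eq_of_le _ hs).symm) hu₁T)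
  filter_upwards [h] with ω hω using hω (by exact_mod_cast horizon_le n ε T ω)

/-- The same, with the horizon read off the stopped path itself. [cite: Lawler2005, §6.5 Prop. 6.21] -/
theorem ae_locallyGeneratedSimple_stopPath' [IsProbabilityMeasure P] (hB : IsBrownianReal B P)
    (hBm : ∀ t, Measurable (B t)) (hBc : ∀ ω, Continuous (B · ω)) (hB0 : ∀ ω, B 0 ω = 0)
    (hκ : 0 < κ) (hκ4 : κ ≤ 4) {n : ℕ} {ε : ℝ} (hε : 0 < ε) (hε2 : ε < π / 2) (hnε : 2 * level n < ε / 2)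
    (T : ℝ≥0) :
    ∀ᵐ ω ∂P, LocallyGeneratedSimple (stopPath T (bmDriving κ B ω))
      (pathHorizon n ε T ⟨stopPath T (bmDriving κ B ω), continuous_stopPath T (continuous_bmDriving hBc ω)⟩) := by
  filter_upwards [ae_locallyGeneratedSimple_stopPath hB hBm hBc hB0 hκ hκ4 hε hε2 hnε T] with ω hω
  rwa [show (⟨stopPath T (bmDriving κ B ω), continuous_stopPath T (continuous_bmDriving hBc ω)⟩ : CPath) =
      ⟨stopPath T (bmPath κ B hBc ω).1, continuous_stopPath T (bmPath κ B hBc ω).2⟩ from rfl,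
    pathHorizon_stopPath, ← horizon_eq_pathHorizon]

end RadialSLE

end RandomPlanarGeometry

end Literature.Probability
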